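import Mathlib
import HarnessLib
import Literature.MathematicalPhysics.QuantumLattice.KohnLuttinger
import Literature.MathematicalPhysics.QuantumLattice.KohnLuttingerFermiCurvePolar
import Literature.MathematicalPhysics.QuantumLattice.KohnLuttingerLindhardMeasurable
import Summits.HubbardSuperconductivity.HubbardSuperconductivity.Theorems.WeakCouplingBCSWcbcsKohnLuttingerB1gReduction
import Summits.HubbardSuperconductivity.HubbardSuperconductivity.Theorems.WeakCouplingBCSKlSublatticePieces

/-!
# The sublattice cover preserves Lebesgue measure on the zone; exact transport of the filling and of the
# Lindhard function («sublattice-duality» discharge, part 3: supports S1, S2 of hubbard-klscan-idea-3; seat p4 g20)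

* `klsl_map_cover_of_affine` — the transport engine: if every affine piece `A + c` pushes `ν'` to `½ ν₀`, then
  `Φ_* (ν'⌊(BZ ∩ Φ⁻¹T)) = ν₀⌊(BZ ∩ T)` (central piece: `½ ν₀` on the zone; corner pieces: `½ ν₀` on the four tiling
  triangles).  Used here with `ν' = ν₀ = vol`, and in part 4 with the Fermi-curve measures.
* `klsl_map_cover_volume`    — `Φ_* (vol⌊BZ) = vol⌊BZ`.
* `klsl_filling_sublattice`  — **S2 `FillingSublattice`**: `n[squareDispersion 0 1](μ) = n[squareDispersion 1 0](μ)`, all `μ`.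
* `klsl_lindhardFunction_sublattice` — **S1 `LindhardSublattice`**:
  `χ₀[squareDispersion 0 1](μ, q) = χ₀[squareDispersion 1 0](μ, A q)`, all `μ, q` (Bochner junk values included),
  hence `Γ'(k, k') = Γ(A k, A k')` and `μ'(n) = μ(n)`.

Honest framing: exact identities between two free-band objects; nothing here asserts a margin at any `t'`, the window,
`K₃` or superconductivity; a Kohn–Luttinger `O(U²)` channel statement is not ODLRO.
-/

noncomputable section

set_option linter.dupNamespace false

namespace Summit.HubbardSuperconductivity.HubbardSuperconductivity.Theorems

open MeasureTheory Real Set Literature.MathematicalPhysics.QuantumLattice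
open scoped ENNReal Pointwise

/-! ### §6 The cover pushes measures forward piece by piece -/

/-- **One piece.** If `Φ = A + c` on a measurable piece `P` which is the `(A + c)`-preimage of a measurable `Q`, and
`(A + c)_* ν' = ½ ν₀`, then `Φ_* (ν'⌊(P ∩ Φ⁻¹ T)) = ½ ν₀⌊(Q ∩ T)`. [folklore] -/
theorem klsl_map_cover_piece {ν' ν₀ : Measure Momentum} {a b : ℝ}
    (hA : Measure.map (fun k => klslA k + klslVec a b) ν' = (2 : ℝ≥0∞)⁻¹ • ν₀)
    {P Q T : Set Momentum} (hQ : MeasurableSet Q) (hT : MeasurableSet T)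
    (hΦ : ∀ k ∈ P, klslCover k = klslA k + klslVec a b) (hpre : (fun k => klslA k + klslVec a b) ⁻¹' Q = P) :
    Measure.map klslCover (ν'.restrict (P ∩ klslCover ⁻¹' T)) = (2 : ℝ≥0∞)⁻¹ • ν₀.restrict (Q ∩ T) := by
  have hmeasA : Measurable (fun k => klslA k + klslVec a b) := measurable_klslA.add_const _
  have hset : P ∩ klslCover ⁻¹' T = (fun k => klslA k + klslVec a b) ⁻¹' (Q ∩ T) := by
    ext k
    constructor
    · rintro ⟨hkP, hkT⟩
      have hkQ : k ∈ (fun k => klslA k + klslVec a b) ⁻¹' Q := by rw [hpre]; exact hkP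
      refine ⟨hkQ, ?_⟩
      show klslA k + klslVec a b ∈ T
      rw [← hΦ k hkP]
      exact hkT
    · rintro ⟨hkQ, hkT⟩
      have hkP : k ∈ P := by rw [← hpre]; exact hkQ
      refine ⟨hkP, ?_⟩
      show klslCover k ∈ T
      rw [hΦ k hkP]
      exact hkT
  have hcongr : klslCover =ᵐ[ν'.restrict ((fun k => klslA k + klslVec a b) ⁻¹' (Q ∩ T))]
      (fun k => klslA k + klslVec a b) := by
    refine (ae_restrict_iff' (hmeasA (hQ.inter hT))).2 (Filter.Eventually.of_forall fun k hk => ?_)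
    have hkP : k ∈ P := by rw [← hpre]; exact hk.1
    exact hΦ k hkP
  rw [hset, Measure.map_congr hcongr, ← Measure.restrict_map hmeasA (hQ.inter hT), hA, Measure.restrict_smul]

/-- **The cover, all pieces.** If every affine piece `A + c` pushes `ν'` to `½ ν₀`, then for every measurable `T`
`Φ_* (ν'⌊(BZ ∩ Φ⁻¹ T)) = ν₀⌊(BZ ∩ T)`: the central piece contributes `½ ν₀⌊(BZ ∩ T)` and the four outer pieces
contribute `½ ν₀` on the four triangles tiling the zone. [folklore] -/
theorem klsl_map_cover_of_affine {ν' ν₀ : Measure Momentum}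
    (hA : ∀ a b : ℝ, (∃ m : ℤ, a = m * (2 * π)) → (∃ n : ℤ, b = n * (2 * π)) →
      Measure.map (fun k => klslA k + klslVec a b) ν' = (2 : ℝ≥0∞)⁻¹ • ν₀)
    {T : Set Momentum} (hT : MeasurableSet T) :
    Measure.map klslCover (ν'.restrict (brillouinZone ∩ klslCover ⁻¹' T)) = ν₀.restrict (brillouinZone ∩ T) := by
  have h0 : ∃ m : ℤ, (0 : ℝ) = m * (2 * π) := ⟨0, by simp⟩
  have h1 : ∃ m : ℤ, 2 * π = m * (2 * π) := ⟨1, by simp⟩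
  have hm1 : ∃ m : ℤ, -(2 * π) = m * (2 * π) := ⟨-1, by simp⟩
  have hdec := klsl_restrict_pieces (ν'.restrict (klslCover ⁻¹' T))
  simp only [Measure.restrict_restrict measurableSet_brillouinZone, Measure.restrict_restrict klsl_measurableSet_P1,
    Measure.restrict_restrict klsl_measurableSet_P2, Measure.restrict_restrict klsl_measurableSet_P3,
    Measure.restrict_restrict klsl_measurableSet_P4, Measure.restrict_restrict klsl_measurableSet_P0] at hdec
  rw [hdec, Measure.map_add _ _ measurable_klslCover, Measure.map_add _ _ measurable_klslCover,
    Measure.map_add _ _ measurable_klslCover, Measure.map_add _ _ measurable_klslCover,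
    klsl_map_cover_piece (hA _ _ hm1 h0) klsl_measurableSet_Q1 hT (fun k hk => klslCover_of_mem_P1 hk) klsl_preimage_Q1,
    klsl_map_cover_piece (hA _ _ h1 h0) klsl_measurableSet_Q2 hT (fun k hk => klslCover_of_mem_P2 hk) klsl_preimage_Q2,
    klsl_map_cover_piece (hA _ _ h0 hm1) klsl_measurableSet_Q3 hT (fun k hk => klslCover_of_mem_P3 hk) klsl_preimage_Q3,
    klsl_map_cover_piece (hA _ _ h0 h1) klsl_measurableSet_Q4 hT (fun k hk => klslCover_of_mem_P4 hk) klsl_preimage_Q4,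
    klsl_map_cover_piece (hA _ _ h0 h0) measurableSet_brillouinZone hT (fun k hk => klslCover_of_mem_P0 hk) klsl_preimage_Q0]
  have htri := klsl_restrict_triangles (ν₀.restrict T)
  simp only [Measure.restrict_restrict measurableSet_brillouinZone, Measure.restrict_restrict klsl_measurableSet_Q1,
    Measure.restrict_restrict klsl_measurableSet_Q2, Measure.restrict_restrict klsl_measurableSet_Q3,
    Measure.restrict_restrict klsl_measurableSet_Q4] at htri
  rw [← smul_add, ← smul_add, ← smul_add, htri, ← smul_add, ← two_smul ℝ≥0∞ (ν₀.restrict (brillouinZone ∩ T)),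
    smul_smul, ENNReal.inv_mul_cancel two_ne_zero ENNReal.ofNat_ne_top, one_smul]

/-- **The folded sublattice cover preserves Lebesgue measure on the zone**: `Φ_* (vol⌊BZ) = vol⌊BZ`. [folklore] -/
theorem klsl_map_cover_volume :
    Measure.map klslCover ((volume : Measure Momentum).restrict brillouinZone) = volume.restrict brillouinZone := by
  have h := klsl_map_cover_of_affine (ν' := volume) (ν₀ := volume) (fun a b _ _ => map_klslA_add_volume _)
    MeasurableSet.univ
  rwa [preimage_univ, inter_univ] at h

/-- The cover as a measure-preserving self-map of `(BZ, vol)`. [folklore] -/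
theorem klsl_measurePreserving_cover :
    MeasurePreserving klslCover ((volume : Measure Momentum).restrict brillouinZone) (volume.restrict brillouinZone) :=
  ⟨measurable_klslCover, klsl_map_cover_volume⟩

/-! ### §7 The two exact transports: filling (S2) and Lindhard function (S1) -/

/-- **Support S2 `FillingSublattice` — the filling transports exactly**: `n[squareDispersion 0 1](μ) =
n[squareDispersion 1 0](μ)` for every `μ` (the occupation of `ε'` at `p` is the occupation of `ε` at `Φ p`, and `Φ`
preserves `vol⌊BZ`). [folklore] -/
theorem klsl_filling_sublattice (μ : ℝ) :
    KohnLuttinger.filling (squareDispersion 0 1) μ = KohnLuttinger.filling (squareDispersion 1 0) μ := by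
  unfold KohnLuttinger.filling
  have hpt : ∀ p, fermiOccupation (squareDispersion 0 1) μ p = fermiOccupation (squareDispersion 1 0) μ (klslCover p) := by
    intro p
    simp only [fermiOccupation, klsl_squareDispersion_cover]
  have hint : ∫ p in brillouinZone, fermiOccupation (squareDispersion 0 1) μ p =
      ∫ p in brillouinZone, fermiOccupation (squareDispersion 1 0) μ p := by
    have h := integral_map (μ := (volume : Measure Momentum).restrict brillouinZone) measurable_klslCover.aemeasurable
      (f := fermiOccupation (squareDispersion 1 0) μ)
      (measurable_fermiOccupation (measurable_squareDispersion 1 0) μ).aestronglyMeasurable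
    rw [klsl_map_cover_volume] at h
    rw [h]
    exact integral_congr_ae (Filter.Eventually.of_forall hpt)
  rw [hint]

/-- The Lindhard integrand of `ε'` at transfer `q` and momentum `p` is the Lindhard integrand of `ε` at transfer `A q` and
momentum `Φ p` (`ε(Φ p) = ε'(p)`, `ε(Φ p + A q) = ε'(p + q)`). [folklore] -/
theorem klsl_lindhardIntegrand_cover (μ : ℝ) (q p : Momentum) :
    lindhardIntegrand (squareDispersion 1 0) μ (klslA q) (klslCover p) = lindhardIntegrand (squareDispersion 0 1) μ q p := by
  simp only [lindhardIntegrand, fermiOccupation, klsl_squareDispersion_cover, klsl_squareDispersion_cover_add]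

/-- **Support S1 `LindhardSublattice` — the Lindhard function transports exactly**:
`χ₀[squareDispersion 0 1](μ, q) = χ₀[squareDispersion 1 0](μ, A q)` for every `μ` and `q` (Bochner junk values
included: both sides are integrals of the same function against `Φ_*(vol⌊BZ) = vol⌊BZ`). [folklore] -/
theorem klsl_lindhardFunction_sublattice (μ : ℝ) (q : Momentum) :
    lindhardFunction (squareDispersion 0 1) μ q = lindhardFunction (squareDispersion 1 0) μ (klslA q) := by
  unfold lindhardFunction
  have hint : ∫ p in brillouinZone, lindhardIntegrand (squareDispersion 0 1) μ q p =
      ∫ p in brillouinZone, lindhardIntegrand (squareDispersion 1 0) μ (klslA q) p := by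
    have h := integral_map (μ := (volume : Measure Momentum).restrict brillouinZone) measurable_klslCover.aemeasurable
      (f := lindhardIntegrand (squareDispersion 1 0) μ (klslA q))
      (measurable_lindhardIntegrand (measurable_squareDispersion 1 0) μ (klslA q)).aestronglyMeasurable
    rw [klsl_map_cover_volume] at h
    rw [h]
    exact integral_congr_ae (Filter.Eventually.of_forall fun p => (klsl_lindhardIntegrand_cover μ q p).symm)
  rw [hint]

/-- S1 read on the Kohn–Luttinger kernel: `Γ'[μ, U](k, k') = Γ[μ, U](A k, A k')`. [folklore] -/
theorem klsl_kohnLuttingerKernel_sublattice (μ U : ℝ) (k k' : Momentum) :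
    kohnLuttingerKernel (squareDispersion 0 1) μ U k k' =
      kohnLuttingerKernel (squareDispersion 1 0) μ U (klslA k) (klslA k') := by
  rw [kohnLuttingerKernel, kohnLuttingerKernel, klsl_lindhardFunction_sublattice, klslA_add]

/-- S2 read on the chemical potential: the two bands have the same `μ(n)` at every density. [folklore] -/
theorem klsl_chemicalPotentialOfDensity_sublattice (n : ℝ) :
    chemicalPotentialOfDensity (squareDispersion 0 1) n = chemicalPotentialOfDensity (squareDispersion 1 0) n := by
  simp only [chemicalPotentialOfDensity, klsl_filling_sublattice]

end Summit.HubbardSuperconductivity.HubbardSuperconductivity.Theorems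

end
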